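import Literature.AlgebraicGeometry.AbelianSchemes.AbelianSchemeOverQuasiInverseIsogeny
import Literature.AlgebraicGeometry.Motives.AbelianVarietyEtaleIsogenyFrobeniusKernel
import HarnessLib

/-!
# Quasi-inverse pairs compose: `(d ∘ q, q′ ∘ d′)` is a quasi-inverse pair of exponent `nm`; the kernel OBJECT of `d ∘ q` is finite flat — ANY base
# ([MumfordAV1970] §19 Remark p. 169; [GortzWedhorn2023] Def. 27.176, Cor. 27.177 (1))

Topic `Literature/AlgebraicGeometry/AbelianSchemes`; namespaces `Literature.AlgebraicGeometry.GroupSchemes.QuasiInverse` (§1, any cartesian monoidal category)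
and `Literature.AlgebraicGeometry.AbelianSchemes.AbelianSchemeOver` (§2).  THEOREMS ONLY (no definition, no instance, no notation, no named fact, no `sorry`).
Cell `hodgecm-mathlib` (D-0151), programme P6 «MOD» (crux hLiu418 = stmt-HodgeConjecture-24832, `--supports`, count-neutral): organ **(F-q∘) «QUASI-INVERSE PAIRS
COMPOSE; `Ker (d ∘ q) → S` IS FINITE FLAT»** of the FLATNESS-INPUT road of line L2 ∕ socket `stub_DOWN` (LA2-p04 (g0); LA2-plan default 2026-09-02T02:42:55Z «the
`[Flat (ker (d ∘ q)).hom]` recipe»): the hypothesis `[Flat (Ker ψ → S)]` of ★ `LayerMapKernelBlock.flat_quotient_map_ker_counit_of_block` ∕ `…range_comap_of_block` for the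
reduced hom `ψ = d ∘ q` of (O1) `stub_SPEC` (P6c census §2.2: `q` the roof quotient with `q q′ = [p]`-type quasi-inverse from (r3), `d` a Serre-cover cofactor with
`c d = ι(a)`), over the NON-noetherian valuation ring `𝒪_Ω̄` where only the quasi-inverse door (★ `AbelianSchemeOverQuasiInverseIsogeny`, any base) is open.
HC_CM is proved only modulo the printed citations until rung 0 closes; this file is generic and changes no count.

THE MATHEMATICS ([MumfordAV1970] §19 Remark p. 169: an isogeny `f` of degree `n` has a quasi-inverse `g`, `fg = [n]`, `gf = [n]`; [GortzWedhorn2023] Def. 27.176,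
Cor. 27.177 (1)).  In a cartesian monoidal category, for group objects `A, B, D`, homomorphisms `q : A → B`, `d : B → D` and morphisms `q′ : B → A`, `d′ : D → B`
with `q q′ = [n]_A`, `q′ q = [n]_B`, `d d′ = [m]_B`, `d′ d = [m]_D` (`[n]_X = (𝟙 X)^n`, the pointwise power): `(qd)(d′q′) = q [m]_B q′ = [m]_A q q′ = [m]_A [n]_A =
[nm]_A` (a homomorphism commutes with `[m]`, ★ `pow_id_comp_eq_comp_pow_id`; `[m] ≫ [n] = [mn]`, Mathlib `MonObj.comp_pow`) and `(d′q′)(qd) = d′ [n]_B d = d′ d [n]_D =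
[nm]_D`.  Hence (★ `flat_left_of_quasiInverse`, `isFinite_left_…`, any base, any characteristic) `d ∘ q` is finite, flat and surjective, and its KERNEL OBJECT `Ker (d ∘ q)
= S ×_{e,D} A → S` (★ `GroupSchemeKernel.ker`; base change along the unit section, ★ `GroupSchemeKernel.flat_ker_hom_of_flat_left`) is finite and flat.

## Contents
* §1 (any cartesian monoidal `C`) `pow_id_comp_pow_id` (`[m] ≫ [n] = [m·n]`), **`comp_comp_eq_pow_id_of_quasiInverse`** ∕ **`comp_comp_eq_pow_id_of_quasiInverse'`** (the two
  identities of the composite pair).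
* §2 (abelian schemes, any base) `flat_ker_hom_of_quasiInverse`, `isFinite_ker_hom_of_quasiInverse` (kernel OBJECT of one quasi-invertible hom), HEADS
  **`flat_left_comp_of_quasiInverse`**, **`flat_ker_hom_comp_of_quasiInverse`**, **`isFinite_ker_hom_comp_of_quasiInverse`**, `surjective_left_comp_of_quasiInverse`.

## References
* [MumfordAV1970] D. Mumford, *Abelian Varieties* (1970), §19 Remark p. 169.
* [GortzWedhorn2023] U. Görtz, T. Wedhorn, *Algebraic Geometry II* (2023), Def. 27.176, Cor. 27.177 (1), Prop. 27.186.
* [GortzWedhorn2020] U. Görtz, T. Wedhorn, *Algebraic Geometry I*, 2nd ed. (2020), Definition 4.45 (2) p. 117.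
-/

set_option autoImplicit false

noncomputable section

universe u

open CategoryTheory CategoryTheory.Limits AlgebraicGeometry MonoidalCategory CartesianMonoidalCategory

/-! ## §1 The composite of two quasi-inverse pairs is a quasi-inverse pair -/

namespace Literature.AlgebraicGeometry.GroupSchemes.QuasiInverse

open scoped MonObj

variable {C : Type*} [Category C] [CartesianMonoidalCategory C]

/-- **`[m] ≫ [n] = [m·n]`** for the pointwise powers of the identity of a monoid object (Mathlib `MonObj.comp_pow`, `pow_mul`). [cite: GortzWedhorn2023, Def. 27.176] -/
theorem pow_id_comp_pow_id {X : C} [MonObj X] (m n : ℕ) : ((𝟙 X : X ⟶ X) ^ m) ≫ ((𝟙 X : X ⟶ X) ^ n) = (𝟙 X : X ⟶ X) ^ (m * n) := by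
  rw [MonObj.comp_pow, Category.comp_id, pow_mul]

/-- A homomorphism commutes with `[N]`: `[N] ≫ φ = φ ≫ [N]` (Mathlib `MonObj.pow_comp`, `MonObj.comp_pow`; the ★ `IdempotentSplittingFixMap` lemma in any cartesian monoidal
category). [cite: GortzWedhorn2023, Def. 27.176] -/
theorem pow_id_comp_eq_comp_pow_id {A B : C} [MonObj A] [MonObj B] (φ : A ⟶ B) [IsMonHom φ] (N : ℕ) :
    ((𝟙 A : A ⟶ A) ^ N) ≫ φ = φ ≫ (𝟙 B : B ⟶ B) ^ N := by
  rw [MonObj.pow_comp, Category.id_comp, MonObj.comp_pow, Category.comp_id]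

/-- **QUASI-INVERSE PAIRS COMPOSE, first identity: `(q ≫ d) ≫ (d′ ≫ q′) = [m·n]_A`** (`q` a homomorphism; `q ≫ q′ = [n]_A`, `d ≫ d′ = [m]_B`).
[cite: MumfordAV1970, §19 Remark p. 169] [cite: GortzWedhorn2023, Def. 27.176] -/
theorem comp_comp_eq_pow_id_of_quasiInverse {A B D : C} [MonObj A] [MonObj B] [MonObj D] (q : A ⟶ B) [IsMonHom q] (d : B ⟶ D) (q' : B ⟶ A) (d' : D ⟶ B)
    {n m : ℕ} (hq : q ≫ q' = (𝟙 A : A ⟶ A) ^ n) (hd : d ≫ d' = (𝟙 B : B ⟶ B) ^ m) :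
    (q ≫ d) ≫ (d' ≫ q') = (𝟙 A : A ⟶ A) ^ (m * n) := by
  rw [Category.assoc, ← Category.assoc d, hd, ← Category.assoc, ← pow_id_comp_eq_comp_pow_id q m, Category.assoc, hq, pow_id_comp_pow_id]

/-- **QUASI-INVERSE PAIRS COMPOSE, second identity: `(d′ ≫ q′) ≫ (q ≫ d) = [m·n]_D`** (`d` a homomorphism; `q′ ≫ q = [n]_B`, `d′ ≫ d = [m]_D`).
[cite: MumfordAV1970, §19 Remark p. 169] [cite: GortzWedhorn2023, Def. 27.176] -/
theorem comp_comp_eq_pow_id_of_quasiInverse' {A B D : C} [MonObj A] [MonObj B] [MonObj D] (q : A ⟶ B) (d : B ⟶ D) [IsMonHom d] (q' : B ⟶ A) (d' : D ⟶ B)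
    {n m : ℕ} (hq' : q' ≫ q = (𝟙 B : B ⟶ B) ^ n) (hd' : d' ≫ d = (𝟙 D : D ⟶ D) ^ m) :
    (d' ≫ q') ≫ (q ≫ d) = (𝟙 D : D ⟶ D) ^ (m * n) := by
  rw [Category.assoc, ← Category.assoc q', hq', pow_id_comp_eq_comp_pow_id d n, ← Category.assoc, hd', pow_id_comp_pow_id]

end Literature.AlgebraicGeometry.GroupSchemes.QuasiInverse

/-! ## §2 Abelian schemes over any base: the kernel object of a (composite) quasi-invertible homomorphism is finite flat -/

namespace Literature.AlgebraicGeometry.AbelianSchemes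

namespace AbelianSchemeOver

open scoped MonObj CategoryTheory.Obj
open Literature.AlgebraicGeometry.GroupSchemes

variable {S : Scheme.{u}} {A B D : AbelianSchemeOver S}

/-- **THE KERNEL OBJECT `Ker φ → S` OF A QUASI-INVERTIBLE HOMOMORPHISM IS FLAT** (any base; ★ `flat_left_of_quasiInverse` + ★ `GroupSchemeKernel.flat_ker_hom_of_flat_left`:
`Ker φ → S` is the base change of the flat `φ` along the unit section). [cite: GortzWedhorn2023, Cor. 27.177 (1)] [cite: GortzWedhorn2020, Definition 4.45 (2), p. 117] -/
theorem flat_ker_hom_of_quasiInverse (φ : A.X ⟶ B.X) [IsMonHom φ] (ψ : B.X ⟶ A.X) {N : ℕ} (hN : N ≠ 0)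
    (hφψ : φ ≫ ψ = (𝟙 A.X : A.X ⟶ A.X) ^ N) (hψφ : ψ ≫ φ = (𝟙 B.X : B.X ⟶ B.X) ^ N) : Flat (GroupSchemeKernel.ker φ).hom := by
  haveI := flat_left_of_quasiInverse φ ψ hN hφψ hψφ
  exact GroupSchemeKernel.flat_ker_hom_of_flat_left φ

/-- **… AND FINITE** (★ `isFinite_left_of_quasiInverse` + ★ `GroupSchemeKernel.isFinite_ker_hom_of_isFinite_left`). [cite: GortzWedhorn2023, Cor. 27.177 (1)] -/
theorem isFinite_ker_hom_of_quasiInverse (φ : A.X ⟶ B.X) [IsMonHom φ] (ψ : B.X ⟶ A.X) {N : ℕ} (hN : N ≠ 0)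
    (hφψ : φ ≫ ψ = (𝟙 A.X : A.X ⟶ A.X) ^ N) (hψφ : ψ ≫ φ = (𝟙 B.X : B.X ⟶ B.X) ^ N) : IsFinite (GroupSchemeKernel.ker φ).hom := by
  haveI := isFinite_left_of_quasiInverse φ ψ hN hφψ hψφ
  exact GroupSchemeKernel.isFinite_ker_hom_of_isFinite_left φ

variable (q : A.X ⟶ B.X) (d : B.X ⟶ D.X) [IsMonHom q] [IsMonHom d] (q' : B.X ⟶ A.X) (d' : D.X ⟶ B.X) {n m : ℕ}

/-- **HEAD — `d ∘ q` IS FLAT** for two quasi-inverse pairs `(q, q′; n)`, `(d, d′; m)`, `n, m ≠ 0` (§1 + ★ `flat_left_of_quasiInverse`). [cite: GortzWedhorn2023, Cor. 27.177 (1)]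
[cite: MumfordAV1970, §19 Remark p. 169] -/
theorem flat_left_comp_of_quasiInverse (hn : n ≠ 0) (hm : m ≠ 0)
    (hq : q ≫ q' = (𝟙 A.X : A.X ⟶ A.X) ^ n) (hq' : q' ≫ q = (𝟙 B.X : B.X ⟶ B.X) ^ n)
    (hd : d ≫ d' = (𝟙 B.X : B.X ⟶ B.X) ^ m) (hd' : d' ≫ d = (𝟙 D.X : D.X ⟶ D.X) ^ m) : Flat (q ≫ d).left :=
  flat_left_of_quasiInverse (q ≫ d) (d' ≫ q') (mul_ne_zero hm hn)
    (QuasiInverse.comp_comp_eq_pow_id_of_quasiInverse q d q' d' hq hd) (QuasiInverse.comp_comp_eq_pow_id_of_quasiInverse' q d q' d' hq' hd')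

/-- **`d ∘ q` IS SURJECTIVE.** [cite: GortzWedhorn2023, Cor. 27.177 (1)] -/
theorem surjective_left_comp_of_quasiInverse (hn : n ≠ 0) (hm : m ≠ 0)
    (hq : q ≫ q' = (𝟙 A.X : A.X ⟶ A.X) ^ n) (hq' : q' ≫ q = (𝟙 B.X : B.X ⟶ B.X) ^ n)
    (hd : d ≫ d' = (𝟙 B.X : B.X ⟶ B.X) ^ m) (hd' : d' ≫ d = (𝟙 D.X : D.X ⟶ D.X) ^ m) : Surjective (q ≫ d).left :=
  surjective_left_of_quasiInverse (q ≫ d) (d' ≫ q') (mul_ne_zero hm hn)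
    (QuasiInverse.comp_comp_eq_pow_id_of_quasiInverse q d q' d' hq hd) (QuasiInverse.comp_comp_eq_pow_id_of_quasiInverse' q d q' d' hq' hd')

/-- **HEAD — THE KERNEL OBJECT `Ker (d ∘ q) → S` IS FLAT** — the `[Flat (ker ψ).hom]` input of ★ `LayerMapKernelBlock` for `ψ = d ∘ q`.
[cite: GortzWedhorn2023, Cor. 27.177 (1)] [cite: MumfordAV1970, §19 Remark p. 169] -/
theorem flat_ker_hom_comp_of_quasiInverse (hn : n ≠ 0) (hm : m ≠ 0)
    (hq : q ≫ q' = (𝟙 A.X : A.X ⟶ A.X) ^ n) (hq' : q' ≫ q = (𝟙 B.X : B.X ⟶ B.X) ^ n)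
    (hd : d ≫ d' = (𝟙 B.X : B.X ⟶ B.X) ^ m) (hd' : d' ≫ d = (𝟙 D.X : D.X ⟶ D.X) ^ m) : Flat (GroupSchemeKernel.ker (q ≫ d)).hom :=
  flat_ker_hom_of_quasiInverse (q ≫ d) (d' ≫ q') (mul_ne_zero hm hn)
    (QuasiInverse.comp_comp_eq_pow_id_of_quasiInverse q d q' d' hq hd) (QuasiInverse.comp_comp_eq_pow_id_of_quasiInverse' q d q' d' hq' hd')

/-- **… AND FINITE.** [cite: GortzWedhorn2023, Cor. 27.177 (1)] -/
theorem isFinite_ker_hom_comp_of_quasiInverse (hn : n ≠ 0) (hm : m ≠ 0)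
    (hq : q ≫ q' = (𝟙 A.X : A.X ⟶ A.X) ^ n) (hq' : q' ≫ q = (𝟙 B.X : B.X ⟶ B.X) ^ n)
    (hd : d ≫ d' = (𝟙 B.X : B.X ⟶ B.X) ^ m) (hd' : d' ≫ d = (𝟙 D.X : D.X ⟶ D.X) ^ m) : IsFinite (GroupSchemeKernel.ker (q ≫ d)).hom :=
  isFinite_ker_hom_of_quasiInverse (q ≫ d) (d' ≫ q') (mul_ne_zero hm hn)
    (QuasiInverse.comp_comp_eq_pow_id_of_quasiInverse q d q' d' hq hd) (QuasiInverse.comp_comp_eq_pow_id_of_quasiInverse' q d q' d' hq' hd')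

end AbelianSchemeOver

end Literature.AlgebraicGeometry.AbelianSchemes

end
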